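import Summits.BirchSwinnertonDyer.Rank1Residual.F1Sign2.ModularDegreeCubicFieldAtTwo
import HarnessLib

/-!
# Cell `bsd-f1-sign2` — kernel glue for `F1Sign2/ModularDegreeCubicFieldAtTwo.lean` (file 2 of 2 of the MEMO-an v1.62 §24 port): the five checked
# compositions of -an's `Sketch_v56.lean` 7f7cac80d556a840 (§24.4 «Kernel glue (checked)» + `threeBit_forward`, VERBATIM) and REF1 §174's PROOF of S38c

THEOREMS ONLY (no `def`, no `sorry`, no named fact, no instance; ns `…F1Sign2.ANg21` as file 1).  Contents: `nuIff_fiveModEight_of_parts` (AN-38♮ ⟸ AN-37d♮ +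
AN-35e + AN-38♮⟸), `nuIffSha_of_nuIff` (AN-38♮Ш ⟸ AN-38♮), `nuOne_fiveModEight_of_threeBit` (AN-38♮⟸ ⟸ AN-38 + AN-38♮′ + S38a + existence),
`nuOne_threeModFour_of_threeBit` (AN-38♭⟸ ⟸ AN-38 + S38b), `threeBit_forward` (the ⟹ half of AN-38) — all -an's, byte-identical; and
**`minimalDiscriminantFiveModEightOfSupersingular_holds : MinimalDiscriminantFiveModEightOfSupersingular` (S38c PROVED)** = REF1 g15's
`REF1g15w.s38c_holds` (`HOME/REF1-data/b174/lean/Probe174.lean` e5c27aedea0fe034 l.103–125) landed VERBATIM at REF1's request under REF1's suggested name,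
with its arithmetic core `odd_discr_emod_eight_aux` (= REF1's `aux_mod8`): `a₁ = s + s`; the `ring` identity `Δ = −27 b₆² + 8·Q` with -an's
`Q = −2(s²+a₂)²((s²+a₂)(a₃²+4a₆) − (a₄+s a₃)²) − 8(a₄+s a₃)³ + 9(s²+a₂)(a₄+s a₃)(a₃²+4a₆)` (certified, not sampled); `Δ` odd ⟹ `b₆` odd ⟹ `b₆² ≡ 1 (8)`
⟹ `Δ ≡ −27 ≡ 5 (mod 8)` (`Int.odd_pow'`, `Int.even_mul_succ_self`, `linear_combination`, `omega`).  The §24.4 «Classical faces» glue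
(`nuOne_fiveModEight_of_classical`, `nuIff_rayClassOdd_onSlice`, `eggLocus_of_nuOne_threeModFour`) waits with its statements for REF1 g16 (D-an-111a).
Typer -ty g15 (D-an-112); std axioms re-checked on a combined scratch.  BSD is not proved by this; no item closed.
-/

namespace Summit.BirchSwinnertonDyer.Rank1Residual.F1Sign2.ANg21

open Literature.NumberTheory.EllipticCurves Literature.NumberTheory.EllipticCurves.ModularForms UpperHalfPlane
open Literature.NumberTheory.EllipticCurves.Rank1Residual
open Summit.BirchSwinnertonDyer.Rank1Residual.F1Sign2 Summit.BirchSwinnertonDyer.Rank1Residual.F1Sign2.ANg17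
open Summit.BirchSwinnertonDyer.Rank1Residual.F1Sign2.ANg18 Summit.BirchSwinnertonDyer.Rank1Residual.F1Sign2.ANg19
open Summit.BirchSwinnertonDyer.Rank1Residual.F1Sign2.ANg20
open scoped Classical

noncomputable section

/-! ### §24.4 Kernel glue (checked) — -an Sketch_v56 VERBATIM -/

/-- AN-38♮ from its two arrows: ⟹ = AN-37d♮ (supersingular) + AN-35e (egg locus); ⟸ = AN-38♮⟸. -/
theorem nuIff_fiveModEight_of_parts (hss : NuOneSupersingularAtTwoOfOneModFour) (hegg : ModularDegreeTwoModFourOnEggLocusAtTwo)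
    (hconv : NuOneOfSupersingularOnEggLocusOfFiveModEight) : NuIffSupersingularOnEggLocusOfFiveModEight := by
  intro W _ _ _ hN h5 hΔ h2 hK hr Dt hc hFr h0
  have h41 : W.conductorNorm ℤ % 4 = 1 := by omega
  constructor
  · intro hν
    exact ⟨hss W hN h41 hΔ h2 Dt hFr h0 hν, hegg W hΔ h2 hr Dt hc hFr hν⟩
  · rintro ⟨hS, hE⟩
    exact hconv W hN h5 hΔ h2 hK hr Dt hc hFr h0 hS hE

/-- AN-38♮Ш from AN-38♮: on the supersingular egg-meeting class the iff collapses to `ν = 1 ↔ Ш[2] = 0`. -/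
theorem nuIffSha_of_nuIff (h : NuIffSupersingularOnEggLocusOfFiveModEight) :
    NuIffShaTwoTrivialOfSupersingularMeetsEggFiveModEight := by
  intro W _ _ _ hN h5 hΔ h2 hK hr hS hM hT Dt hc hFr h0
  rw [h W hN h5 hΔ h2 hK hr Dt hc hFr h0]
  unfold OnEggLocusAtTwo
  exact ⟨fun h' => h'.2.2.1, fun hSha => ⟨hS, hM, hSha, hT⟩⟩

/-- The `N ≡ 5 (mod 8)` converse from the three-bit law, the silent (F₃)-bit (AN-38♮′), S38a and the existence of a cubic 2-division field. -/
theorem nuOne_fiveModEight_of_threeBit (h3 : ThreeBitModularDegreeLawAtTwo) (hsel : SelmerStableInCubicFieldOfSupersingularOnEggLocus)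
    (hram : TwoDivisionFieldRamifiedOfSupersingular) (hex : CubicTwoDivisionFieldExists) :
    NuOneOfSupersingularOnEggLocusOfFiveModEight := by
  intro W _ _ _ hN h5 hΔ h2 hK hr Dt hc hFr h0 hS hE
  obtain ⟨F, iF, iN, hF⟩ := hex W h2
  exact (h3 W hN hΔ h2 hK hr Dt hc hFr h0 F hF).2 ⟨hram W h2 hS F hF, hE, hsel W hN h5 hΔ h2 hK hr hS hE F hF⟩

/-- The `N ≡ 3 (mod 4)` converse from the three-bit law and S38b. -/
theorem nuOne_threeModFour_of_threeBit (h3 : ThreeBitModularDegreeLawAtTwo) (hram : TwoDivisionFieldRamifiedOfThreeModFour) :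
    NuOneOfOnEggLocusSelmerStableOfThreeModFour := by
  intro W _ _ _ hN h3' hΔ h2 hK hr Dt hc hFr h0 hE F _ _ hF hSel
  exact (h3 W hN hΔ h2 hK hr Dt hc hFr h0 F hF).2 ⟨hram W hN h3' h2 hK F hF, hE, hSel⟩

/-- The ⟹ half of the three-bit law contains AN-37d♯ (ramified), AN-35e (egg locus) and the Selmer form of AN-37b/37t on this frame. -/
theorem threeBit_forward (h3 : ThreeBitModularDegreeLawAtTwo) :
    ∀ (W : WeierstrassCurve ℚ) [W.IsElliptic] [W.IsGloballyMinimal] [NeZero (W.conductorNorm ℤ)],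
      Nat.Prime (W.conductorNorm ℤ) → 0 < W.Δ → NoRationalTwoTorsion W → SameQuadraticResolventAtTwo W → W.analyticRank = 1 →
      ∀ (Dt : ModularParametrizationData W (W.conductorNorm ℤ)), Odd Dt.c →
        IsFrickeEigen (W.conductorNorm ℤ) Dt.f 1 → modularSymbol Dt.f 0 = 0 → Dt.modularDegree % 4 = 2 →
        ∀ (F : Type) [Field F] [NumberField F], IsCubicTwoDivisionField W F →
          (2 : ℤ) ∣ NumberField.discr F ∧ OnEggLocusAtTwo W ∧ Nat.card ↥((W.baseChange F).selmerGroup 2) = 4 := by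
  intro W _ _ _ hN hΔ h2 hK hr Dt hc hFr h0 hν F _ _ hF
  exact (h3 W hN hΔ h2 hK hr Dt hc hFr h0 F hF).1 hν

/-! ### S38c is a theorem (REF1 §174, `REF1-data/b174/lean/Probe174.lean` l.103–125, landed verbatim; REF1 files nothing by charter) -/

/-- Arithmetic core of S38c (REF1's `aux_mod8`): `Δ = −27 w² + 8 Q` odd ⟹ `w` odd ⟹ `w² ≡ 1 (8)` ⟹ `Δ ≡ −27 ≡ 5 (mod 8)`. -/
theorem odd_discr_emod_eight_aux (w Q : ℤ) (h : Odd (-27 * w ^ 2 + 8 * Q)) : (-27 * w ^ 2 + 8 * Q) % 8 = 5 := by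
  have hw2 : Odd (w ^ 2) := by
    obtain ⟨k, hk⟩ := h
    exact Int.odd_iff.mpr (by omega)
  have hw : Odd w := (Int.odd_pow' two_ne_zero).mp hw2
  obtain ⟨t, ht⟩ := hw
  obtain ⟨m, hm⟩ := Int.even_mul_succ_self t
  have hsq : w ^ 2 = 8 * m + 1 := by rw [ht]; linear_combination 4 * hm
  rw [hsq]; omega

/-- **S38c `MinimalDiscriminantFiveModEightOfSupersingular` IS A THEOREM (sorry-free; REF1 g15 `REF1g15w.s38c_holds`, renamed as REF1 suggested).**
With `a₁ = 2s`: `b₂ = 4(s²+a₂)`, `b₄ = 2(a₄+s a₃)`, `b₆ = a₃²+4a₆`, `b₈ = (s²+a₂)(a₃²+4a₆) − (a₄+s a₃)²`, and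
`Δ = −27 b₆² + 8·(−2u²(u b₆ − v²) − 8v³ + 9u v b₆)` (`u = s²+a₂`, `v = a₄+s a₃`; `ring` — -an's `Q`, certified); then `odd_discr_emod_eight_aux`.
With sameK (`Δ = N m²`, `m` odd ⟹ `m² ≡ 1 (8)`) this gives S37♭ `N ≡ 5 (mod 8)` for supersingular curves on the frame by pure algebra. [folklore] -/
theorem minimalDiscriminantFiveModEightOfSupersingular_holds : MinimalDiscriminantFiveModEightOfSupersingular := by
  intro a₁ a₂ a₃ a₄ a₆ ha hΔ
  obtain ⟨s, hs⟩ := ha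
  have key : (WeierstrassCurve.mk a₁ a₂ a₃ a₄ a₆).Δ = -27 * (a₃ ^ 2 + 4 * a₆) ^ 2 +
      8 * (-2 * (s ^ 2 + a₂) ^ 2 * ((s ^ 2 + a₂) * (a₃ ^ 2 + 4 * a₆) - (a₄ + s * a₃) ^ 2) - 8 * (a₄ + s * a₃) ^ 3 +
        9 * (s ^ 2 + a₂) * (a₄ + s * a₃) * (a₃ ^ 2 + 4 * a₆)) := by
    subst hs
    simp only [WeierstrassCurve.Δ, WeierstrassCurve.b₂, WeierstrassCurve.b₄, WeierstrassCurve.b₆, WeierstrassCurve.b₈]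
    ring
  rw [key] at hΔ ⊢
  exact odd_discr_emod_eight_aux _ _ hΔ

/-! ### APPEND (-ty g15, 2026-08-29T07:2xZ): glue of §24.4 / §24.8 (Sketch_v57 5aeae968dae563e6 l.282–288, 319–339, 389–407 VERBATIM) and REF1 §176's
kernel certificates (`HOME/REF1-AUDIT-v1.md` §176 (a)–(f); `REF1-data/b176/lean/Probe176.lean` acefce8d45ad0c06 l.189–298 VERBATIM, namespace moved from
`…F1Sign2.REF1g16a` to `…F1Sign2.ANg21`; REF1 files nothing by charter — landed here as asked in §176 Notes): `isSquare_units_iff` (a),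
`sq_sub_one_mem_sq` (b), `units_sub_one_mem_of_residue_two` (c), **`calegariEmertonConditionFails_of_rayClassOddAtTwo : RayClassOddAtTwo F →
CalegariEmertonConditionFails F` for every number field** (d), `not_rayClassOddAtTwo_of_noRamifiedPrime` (e), and the cross-consistency glue
`narrow_iff_ray_onSlice_of_laws` / `ce_iff_ray_onSS_of_laws` (f) documenting that the face laws and the rank-free law constrain each other (by T176a/T176b
they coincide on their slices).  Nothing asserted; std axioms. -/

section ClassicalFaces
open NumberField

/-- AN-38♮ (`N ≡ 5 (mod 8)` converse) from the two supersingular-face statements: classical route to the same crux-side conclusion. -/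
theorem nuOne_fiveModEight_of_classical (hce : NuIffCalegariEmertonFailsOfSupersingular)
    (hdict : EggLocusIffCalegariEmertonFails) (hram : TwoDivisionFieldRamifiedOfSupersingular) (hex : CubicTwoDivisionFieldExists) :
    NuOneOfSupersingularOnEggLocusOfFiveModEight := by
  intro W _ _ _ hN h5 hΔ h2 hK hr Dt hc hFr h0 hS hE
  obtain ⟨F, iF, iN, hF⟩ := hex W h2
  exact (hce W hN hΔ h2 hK hr hS Dt hc hFr h0 F hF).2 ((hdict W hN hΔ h2 hK hr F hF (hram W h2 hS F hF)).1 hE)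

/-- Kernel glue: the rank-free law specialises to the rank-one slice frame (the extra AN-37 hypotheses are simply not used). -/
theorem nuIff_rayClassOdd_onSlice (h : TwoExactlyDividesModularDegreeIffRayClassOdd)
    (W : WeierstrassCurve ℚ) [W.IsElliptic] [W.IsGloballyMinimal] [NeZero (W.conductorNorm ℤ)]
    (hN : Nat.Prime (W.conductorNorm ℤ)) (hΔ : 0 < W.Δ) (ht : NoRationalTwoTorsion W) (_hK : SameQuadraticResolventAtTwo W)
    (_hr : W.analyticRank = 1) (Dt : ModularParametrizationData W (W.conductorNorm ℤ)) (hc : Odd Dt.c)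
    (_hF : IsFrickeEigen (W.conductorNorm ℤ) Dt.f 1) (_h0 : modularSymbol Dt.f 0 = 0)
    (F : Type) [Field F] [NumberField F] (hF : IsCubicTwoDivisionField W F) :
    Dt.modularDegree % 4 = 2 ↔ RayClassOddAtTwo F :=
  h W hN hΔ ht Dt hc F hF

/-- The ordinary-ramified face: AN-38♯ + S38e give `ν = 1 ⟹` egg locus there (a classical proof-path for AN-35e on that face). -/
theorem eggLocus_of_nuOne_threeModFour (hn : NuIffNarrowClassNumberOddOfThreeModFour) (hs : EggLocusOfNarrowClassNumberOdd)
    (hex : CubicTwoDivisionFieldExists) :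
    ∀ (W : WeierstrassCurve ℚ) [W.IsElliptic] [W.IsGloballyMinimal] [NeZero (W.conductorNorm ℤ)],
      Nat.Prime (W.conductorNorm ℤ) → W.conductorNorm ℤ % 4 = 3 → 0 < W.Δ → NoRationalTwoTorsion W → SameQuadraticResolventAtTwo W →
      W.analyticRank = 1 → ∀ (Dt : ModularParametrizationData W (W.conductorNorm ℤ)), Odd Dt.c →
        IsFrickeEigen (W.conductorNorm ℤ) Dt.f 1 → modularSymbol Dt.f 0 = 0 → Dt.modularDegree % 4 = 2 → OnEggLocusAtTwo W := by
  intro W _ _ _ hN h3 hΔ h2 hK hr Dt hc hFr h0 hν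
  obtain ⟨F, iF, iN, hF⟩ := hex W h2
  exact hs W hN hΔ h2 hK hr F hF ((hn W hN h3 hΔ h2 hK hr Dt hc hFr h0 F hF).1 hν)

/-! #### REF1 §176 kernel certificates (verbatim from `REF1-data/b176/lean/Probe176.lean`) -/

/-- `IsSquare` in the unit group = `IsSquare` in `𝓞 F` for a unit (a square root of a unit is a unit). -/
theorem isSquare_units_iff {R : Type*} [CommRing R] (u : Rˣ) : IsSquare u ↔ IsSquare (u : R) := by
  constructor
  · rintro ⟨r, hr⟩
    exact ⟨r, by rw [hr, Units.val_mul]⟩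
  · rintro ⟨r, hr⟩
    have hru : IsUnit r := isUnit_of_mul_isUnit_left (by rw [← hr]; exact u.isUnit)
    obtain ⟨r', rfl⟩ := hru
    exact ⟨r', Units.ext (by simpa using hr)⟩

/-- `Q` prime, `2 ∈ Q`, `b² − 1 ∈ Q` ⟹ `b − 1 ∈ Q` AND `b + 1 ∈ Q`, hence `b² − 1 ∈ Q²`. -/
theorem sq_sub_one_mem_sq {R : Type*} [CommRing R] {Q : Ideal R} (hQ : Q.IsPrime) (h2 : (2 : R) ∈ Q) {b : R}
    (hb : b ^ 2 - 1 ∈ Q) : b ^ 2 - 1 ∈ Q ^ 2 := by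
  have hfac : b ^ 2 - 1 = (b - 1) * (b + 1) := by ring
  rw [hfac] at hb ⊢
  rw [sq]
  rcases hQ.mem_or_mem hb with h | h
  · have h' : b + 1 ∈ Q := by
      have := Q.add_mem h h2
      convert this using 1; ring
    exact Ideal.mul_mem_mul h h'
  · have h' : b - 1 ∈ Q := by
      have := Q.sub_mem h h2
      convert this using 1; ring
    exact Ideal.mul_mem_mul h' h

/-- Residue field `𝔽₂` (every element is `≡ 0` or `≡ 1 (mod Q)`) ⟹ every unit is `≡ 1 (mod Q)` («`u ≡ 1 (mod 𝔮)` is automatic»). -/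
theorem units_sub_one_mem_of_residue_two {R : Type*} [CommRing R] {Q : Ideal R} (hQ1 : Q ≠ ⊤)
    (hres : ∀ x : R, x ∈ Q ∨ x - 1 ∈ Q) (u : Rˣ) : (u : R) - 1 ∈ Q := by
  rcases hres u with h | h
  · exact absurd (Q.eq_top_of_isUnit_mem h u.isUnit) hQ1
  · exact h

/-- **The `𝔮⁴`-typing refines the `𝔮²`-typing, for every number field:** `RayClassOddAtTwo F → CalegariEmertonConditionFails F`.
Proof: `π ∈ Q ∖ Q²` (Dedekind), `a := 1 + π ∉ Q`; the law gives `u b² ≡ 1 + π (mod Q⁴)`; if `u ≡ 1 (mod Q²)` then `b² − 1 ≡ π (mod Q²)`, so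
`b² − 1 ∈ Q`, so (`sq_sub_one_mem_sq`) `b² − 1 ∈ Q²`, so `π ∈ Q²` — contradiction. -/
theorem calegariEmertonConditionFails_of_rayClassOddAtTwo (F : Type) [Field F] [NumberField F] (h : RayClassOddAtTwo F) :
    CalegariEmertonConditionFails F := by
  obtain ⟨hodd, Q, hQ, h2, hsurj⟩ := h
  refine ⟨hodd, ?_⟩
  have hQ1 : Q ≠ ⊤ := hQ.ne_top
  have h2Q : (2 : 𝓞 F) ∈ Q := Ideal.pow_le_self two_ne_zero h2
  have hQ0 : Q ≠ ⊥ := by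
    intro hbot
    rw [hbot, Ideal.mem_bot] at h2Q
    exact two_ne_zero h2Q
  obtain ⟨π, hπ1, hπ2⟩ := Ideal.exists_mem_pow_notMem_pow_succ Q hQ0 hQ1 1
  rw [pow_one] at hπ1
  have hπ2' : π ∉ Q ^ 2 := hπ2
  have ha : (1 + π) ∉ Q := by
    intro ha
    apply hQ1
    rw [Ideal.eq_top_iff_one]
    have := Q.sub_mem ha hπ1
    simpa using this
  obtain ⟨u, b, hub⟩ := hsurj (1 + π) ha
  refine ⟨u, Q, hQ, h2, ?_⟩
  intro hu
  apply hπ2'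
  have hQ42 : Q ^ 4 ≤ Q ^ 2 := Ideal.pow_le_pow_right (by norm_num)
  have hQ21 : Q ^ 2 ≤ Q := Ideal.pow_le_self two_ne_zero
  have h1 : (u : 𝓞 F) * b ^ 2 - (1 + π) ∈ Q ^ 2 := hQ42 hub
  have h3 : b ^ 2 - 1 - π ∈ Q ^ 2 := by
    have := (Q ^ 2).sub_mem h1 ((Q ^ 2).mul_mem_right (b ^ 2) hu)
    convert this using 1; ring
  have h4 : b ^ 2 - 1 ∈ Q := by
    have := Q.add_mem (hQ21 h3) hπ1
    convert this using 1; ring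
  have h5 : b ^ 2 - 1 ∈ Q ^ 2 := sq_sub_one_mem_sq hQ h2Q h4
  have h6 := (Q ^ 2).sub_mem h5 h3
  have e : b ^ 2 - 1 - (b ^ 2 - 1 - π) = π := by ring
  rwa [e] at h6

/-- A field with NO prime `Q` with `2 ∈ Q²` (e.g. `F₃` unramified at 2) has `¬ RayClassOddAtTwo F` and `¬ CalegariEmertonConditionFails F` — the
typings carry «`F` ramified at 2» inside them (read-back of the ∃Q clause). -/
theorem not_rayClassOddAtTwo_of_noRamifiedPrime (F : Type) [Field F] [NumberField F]
    (h : ∀ Q : Ideal (𝓞 F), Q.IsPrime → (2 : 𝓞 F) ∉ Q ^ 2) : ¬ RayClassOddAtTwo F ∧ ¬ CalegariEmertonConditionFails F :=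
  ⟨fun ⟨_, Q, hQ, h2, _⟩ => h Q hQ h2, fun ⟨_, _, Q, hQ, h2, _⟩ => h Q hQ h2⟩

/-! #### Cross-consistency the laws force (REF1 §176 (f); formal — the data side is `REF1-data/b176/data/census176.txt`) -/

/-- On the `N ≡ 3 (mod 4)` slice the two AN-38♯ typings must AGREE: `NarrowClassNumberOdd F ↔ RayClassOddAtTwo F` for every cubic 2-division field of a
slice curve carrying an odd-`c` Fricke-plus datum (data: `h⁺ odd ⟺ 𝔮⁴-odd` 231/231). -/
theorem narrow_iff_ray_onSlice_of_laws (hn : NuIffNarrowClassNumberOddOfThreeModFour) (hr4 : TwoExactlyDividesModularDegreeIffRayClassOdd)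
    (W : WeierstrassCurve ℚ) [W.IsElliptic] [W.IsGloballyMinimal] [NeZero (W.conductorNorm ℤ)]
    (hN : Nat.Prime (W.conductorNorm ℤ)) (h3 : W.conductorNorm ℤ % 4 = 3) (hΔ : 0 < W.Δ) (ht : NoRationalTwoTorsion W)
    (hK : SameQuadraticResolventAtTwo W) (hr : W.analyticRank = 1) (Dt : ModularParametrizationData W (W.conductorNorm ℤ)) (hc : Odd Dt.c)
    (hFr : IsFrickeEigen (W.conductorNorm ℤ) Dt.f 1) (h0 : modularSymbol Dt.f 0 = 0)
    (F : Type) [Field F] [NumberField F] (hF : IsCubicTwoDivisionField W F) :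
    NarrowClassNumberOdd F ↔ RayClassOddAtTwo F := by
  rw [← hn W hN h3 hΔ ht hK hr Dt hc hFr h0 F hF, hr4 W hN hΔ ht Dt hc F hF]

/-- On the supersingular slice: `CalegariEmertonConditionFails F ↔ RayClassOddAtTwo F` (data: `𝔮²-odd ⟺ 𝔮⁴-odd` 479/479; on this face it is moreover a
THEOREM of local algebra, see §176 text; `←` is `calegariEmertonConditionFails_of_rayClassOddAtTwo` unconditionally). -/
theorem ce_iff_ray_onSS_of_laws (hce : NuIffCalegariEmertonFailsOfSupersingular) (hr4 : TwoExactlyDividesModularDegreeIffRayClassOdd)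
    (W : WeierstrassCurve ℚ) [W.IsElliptic] [W.IsGloballyMinimal] [NeZero (W.conductorNorm ℤ)]
    (hN : Nat.Prime (W.conductorNorm ℤ)) (hΔ : 0 < W.Δ) (ht : NoRationalTwoTorsion W)
    (hK : SameQuadraticResolventAtTwo W) (hr : W.analyticRank = 1) (hS : GoodSS W 2)
    (Dt : ModularParametrizationData W (W.conductorNorm ℤ)) (hc : Odd Dt.c)
    (hFr : IsFrickeEigen (W.conductorNorm ℤ) Dt.f 1) (h0 : modularSymbol Dt.f 0 = 0)
    (F : Type) [Field F] [NumberField F] (hF : IsCubicTwoDivisionField W F) :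
    CalegariEmertonConditionFails F ↔ RayClassOddAtTwo F := by
  rw [← hce W hN hΔ ht hK hr hS Dt hc hFr h0 F hF, hr4 W hN hΔ ht Dt hc F hF]

end ClassicalFaces

section CompositeFloor

/-- Bookkeeping: at prime level `ω(N) = 1`. -/
theorem omegaConductor_of_prime (W : WeierstrassCurve ℚ) (hN : Nat.Prime (W.conductorNorm ℤ)) : omegaConductor W = 1 := by
  unfold omegaConductor
  rw [Nat.Prime.primeFactors hN, Finset.card_singleton]

/-- Kernel glue: at PRIME level the floor law gives the ⟹ half of AN-38♯ (`deg φ ≡ 2 (mod 4)` ⟹ sameK ∧ `RayClassOddAtTwo F₃`). -/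
theorem rayClassOdd_of_nu_prime (hF : ModularDegreeOnFloorForcesRayClassOdd) :
    ∀ (W : WeierstrassCurve ℚ) [W.IsElliptic] [W.IsGloballyMinimal] [NeZero (W.conductorNorm ℤ)],
      Nat.Prime (W.conductorNorm ℤ) → 0 < W.Δ → NoRationalTwoTorsion W →
      ∀ (Dt : ModularParametrizationData W (W.conductorNorm ℤ)), Odd Dt.c → Dt.modularDegree % 4 = 2 →
        SameQuadraticResolventAtTwo W ∧
          ∀ (F : Type) [Field F] [NumberField F], IsCubicTwoDivisionField W F → RayClassOddAtTwo F := by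
  intro W _ _ _ hN hΔ h2 Dt hc hν
  refine hF W hN.squarefree hΔ h2 Dt hc ?_
  rw [omegaConductor_of_prime W hN]
  intro h4
  have h4' : 4 ∣ Dt.modularDegree := by norm_num at h4; exact h4
  omega

end CompositeFloor

end

end Summit.BirchSwinnertonDyer.Rank1Residual.F1Sign2.ANg21
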